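import Mathlib
import Literature.NumberTheory.LFunctions.Zhang2022.Section8dStatements
import HarnessLib

/-!
# Zhang (2022) §8 p. 49: the engine behind the four "Substituting `x = Pᶻ`" displays
# (DAG nodes `Z22:§8.u051`–`Z22:§8.u054`; part 1 of 2 — generic estimates)

Topic `Literature/NumberTheory/LFunctions/Zhang2022` (Landau–Siegel audit tree; verdict-neutral).
Y. Zhang, *Discrete mean estimates and the Landau–Siegel zero*, arXiv:2211.02515v1 (2022)
[Zhang2022LandauSiegel] — **an unrefereed manuscript under adjudication** (D-0069 width campaign,
layer L2, discharge seat sz-d19). After (8.18) the manuscript writes "Substituting `x = Pᶻ` we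
obtain" four displays (tex L2506–L2521, p. 49), each an `x`-integral of (8.12) rewritten as a
`z`-integral of the printed profiles `𝔣𝔣_{jμ}, 𝔤𝔥_{jμ}` "`+ o(α)`". The EXACT substitution is the
tree's `display818_diag/cross₁/cross₂` (`Section8ChangeOfVariables`); the `o(α)` has two sources:
(i) `𝔣_{jμ}(Pᶻ) = 𝔣𝔣_{jμ}(z) + O(𝓛⁻⁸)`, `𝔤` likewise (`Section8ProfilesAtPz`), divided by `log P = π/α`;
(ii) `log P₂ = (0.5 − 10𝓛^{1.1}𝓛⁻⁹) log P` versus the printed `0.5 log P` ((2.21), §6 `T = e^{𝓛^{1.1}}`).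
This file supplies the generic, profile-independent pieces:

* `integral_perturbation` — ‖p∫₀^θ U − p₀∫₀^{θ₀} V‖ ≤ |p|θδ + |p||θ−θ₀|M + |p−p₀|θ₀M for
  `‖U − V‖ ≤ δ` on `[0,θ]`, `‖V‖ ≤ M` on `[0, max θ θ₀]`;
* sup and Lipschitz bounds for the printed profiles on `|z| ≤ 1`: `‖𝔣𝔣_{jμ}‖, ‖𝔤𝔥_{jμ}‖ ≤ 6`,
  `‖𝔣𝔣_{j6}(z) − 𝔣𝔣_{j6}(w)‖, ‖𝔤𝔥_{j6}(z) − 𝔤𝔥_{j6}(w)‖ ≤ 50|z − w|` (derivative-free, from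
  `‖e^{iu} − 1‖ ≤ |u|`), for the dispatchers `ffP`, `ghP` of `Section8dStatements`;
* the parameters: `Pᶻ = e^{z𝓛⁹}`, `P₁ = Ppow 𝓛⁹ 0.504`, `P₂ = Ppow 𝓛⁹ θ₂` with `θ₂ = log P₂/𝓛⁹ =
  0.5 − 10𝓛^{1.1}𝓛⁻⁹`, `|θ₂ − 0.5| ≤ 10𝓛⁻⁷`, `P^{0.004}T^{10} = P₁/P₂`, and continuity of
  `z ↦ 𝔣_{jμ}(e^{Λz})`, `z ↦ 𝔤_{jμ}(e^{Λz})`.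

WHAT THIS FILE IS NOT: a statement about (8.11)/(8.12) themselves, (8.23)–(8.24), or Theorems 1–2 /
Landau–Siegel zeros. No definitions, no new facts.

## References

* Y. Zhang, arXiv:2211.02515v1 (2022), §8 p. 49 (tex L2506–L2521), (8.13)–(8.18); §2 (2.6),
  (2.21); §6 p. 30 (`T`). [cite: Zhang2022LandauSiegel, §8 p.49]
-/

noncomputable section

open Complex Real MeasureTheory Set

namespace Literature.NumberTheory.LFunctions.Zhang2022.Section8SubstitutionEngine

open Skeleton Section8dStatements

/-! ## The integral perturbation inequality -/

/-- **Perturbing an interval integral in the integrand, the endpoint and the prefactor**: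
`‖p∫₀^θ U − p₀∫₀^{θ₀} V‖ ≤ |p|·θδ + |p|·|θ − θ₀|·M + |p − p₀|·θ₀·M` when `‖U − V‖ ≤ δ` on `[0,θ]`
and `‖V‖ ≤ M` on `[0, max θ θ₀]` (`U` integrable on `[0,θ]`, `V` continuous) — the shape of every
"`… = … + o(α)`" comparison of p. 49. [cite: Zhang2022LandauSiegel, §8 p.49] -/
theorem integral_perturbation {U V : ℝ → ℂ} {θ θ₀ p p₀ δ M : ℝ} (hθ : 0 ≤ θ) (hθ₀ : 0 ≤ θ₀)
    (hU : IntervalIntegrable U volume 0 θ) (hV : Continuous V)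
    (hUV : ∀ z ∈ Icc 0 θ, ‖U z - V z‖ ≤ δ) (hM : ∀ z ∈ Icc 0 (max θ θ₀), ‖V z‖ ≤ M) :
    ‖(p : ℂ) * (∫ z in (0:ℝ)..θ, U z) - (p₀ : ℂ) * ∫ z in (0:ℝ)..θ₀, V z‖ ≤
      |p| * (θ * δ) + |p| * (|θ - θ₀| * M) + |p - p₀| * (θ₀ * M) := by
  have hVi : ∀ a b : ℝ, IntervalIntegrable V volume a b := fun a b => hV.intervalIntegrable a b
  have e1 : (∫ z in (0:ℝ)..θ, U z) - (∫ z in (0:ℝ)..θ, V z) = ∫ z in (0:ℝ)..θ, (U z - V z) :=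
    (intervalIntegral.integral_sub hU (hVi 0 θ)).symm
  have e2 : (∫ z in (0:ℝ)..θ, V z) - (∫ z in (0:ℝ)..θ₀, V z) = ∫ z in θ₀..θ, V z :=
    intervalIntegral.integral_interval_sub_left (hVi 0 θ) (hVi 0 θ₀)
  have split : (p : ℂ) * (∫ z in (0:ℝ)..θ, U z) - (p₀ : ℂ) * ∫ z in (0:ℝ)..θ₀, V z =
      (p : ℂ) * (∫ z in (0:ℝ)..θ, (U z - V z)) + (p : ℂ) * (∫ z in θ₀..θ, V z) +
        ((p : ℂ) - p₀) * ∫ z in (0:ℝ)..θ₀, V z := by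
    rw [← e1, ← e2]; ring
  have b1 : ‖∫ z in (0:ℝ)..θ, (U z - V z)‖ ≤ δ * |θ - 0| := by
    refine intervalIntegral.norm_integral_le_of_norm_le_const fun z hz => hUV z ?_
    rw [Set.uIoc_of_le hθ] at hz
    exact ⟨hz.1.le, hz.2⟩
  have b2 : ‖∫ z in θ₀..θ, V z‖ ≤ M * |θ - θ₀| := by
    refine intervalIntegral.norm_integral_le_of_norm_le_const fun z hz => hM z ?_
    rw [Set.mem_uIoc] at hz
    rcases hz with ⟨h1, h2⟩ | ⟨h1, h2⟩
    · exact ⟨hθ₀.trans h1.le, h2.trans (le_max_left _ _)⟩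
    · exact ⟨hθ.trans h1.le, h2.trans (le_max_right _ _)⟩
  have b3 : ‖∫ z in (0:ℝ)..θ₀, V z‖ ≤ M * |θ₀ - 0| := by
    refine intervalIntegral.norm_integral_le_of_norm_le_const fun z hz => hM z ?_
    rw [Set.uIoc_of_le hθ₀] at hz
    exact ⟨hz.1.le, hz.2.trans (le_max_right _ _)⟩
  rw [sub_zero] at b1 b3
  rw [split]
  calc ‖(p : ℂ) * (∫ z in (0:ℝ)..θ, (U z - V z)) + (p : ℂ) * (∫ z in θ₀..θ, V z) +
          ((p : ℂ) - p₀) * ∫ z in (0:ℝ)..θ₀, V z‖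
      ≤ ‖(p : ℂ) * (∫ z in (0:ℝ)..θ, (U z - V z))‖ + ‖(p : ℂ) * (∫ z in θ₀..θ, V z)‖ +
          ‖((p : ℂ) - p₀) * ∫ z in (0:ℝ)..θ₀, V z‖ := norm_add₃_le
    _ ≤ |p| * (δ * |θ|) + |p| * (M * |θ - θ₀|) + |p - p₀| * (M * |θ₀|) := by
        rw [norm_mul, norm_mul, norm_mul, ← Complex.ofReal_sub, Complex.norm_real, Complex.norm_real,
          Real.norm_eq_abs, Real.norm_eq_abs]
        gcongr
    _ = |p| * (θ * δ) + |p| * (|θ - θ₀| * M) + |p - p₀| * (θ₀ * M) := by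
        rw [abs_of_nonneg hθ, abs_of_nonneg hθ₀]; ring

/-- `‖ab − a₀b₀‖ ≤ ‖a − a₀‖‖b‖ + ‖a₀‖‖b − b₀‖` (private helper). [folklore] -/
private theorem norm_mul_sub_mul_le (a b a₀ b₀ : ℂ) :
    ‖a * b - a₀ * b₀‖ ≤ ‖a - a₀‖ * ‖b‖ + ‖a₀‖ * ‖b - b₀‖ := by
  have h : a * b - a₀ * b₀ = (a - a₀) * b + a₀ * (b - b₀) := by ring
  rw [h]
  exact (norm_add_le _ _).trans (by rw [norm_mul, norm_mul])

/-- Product perturbation with a priori bounds: `‖a − a₀‖ ≤ δ₁`, `‖b − b₀‖ ≤ δ₂`, `‖a₀‖ ≤ M₁`,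
`‖b₀‖ ≤ M₂` ⇒ `‖ab − a₀b₀‖ ≤ δ₁(M₂ + δ₂) + M₁δ₂` (used for `𝔣𝔤 − 𝔣𝔣𝔤𝔥`). [cite: Zhang2022LandauSiegel, §8 p.49] -/
theorem norm_mul_sub_mul_le_of_bounds {a b a₀ b₀ : ℂ} {δ₁ δ₂ M₁ M₂ : ℝ} (ha : ‖a - a₀‖ ≤ δ₁)
    (hb : ‖b - b₀‖ ≤ δ₂) (ha₀ : ‖a₀‖ ≤ M₁) (hb₀ : ‖b₀‖ ≤ M₂) :
    ‖a * b - a₀ * b₀‖ ≤ δ₁ * (M₂ + δ₂) + M₁ * δ₂ := by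
  have hδ₁ : 0 ≤ δ₁ := (norm_nonneg _).trans ha
  have hM₁ : 0 ≤ M₁ := (norm_nonneg _).trans ha₀
  have hbb : ‖b‖ ≤ M₂ + δ₂ := by
    calc ‖b‖ = ‖b₀ + (b - b₀)‖ := by congr 1; ring
      _ ≤ ‖b₀‖ + ‖b - b₀‖ := norm_add_le _ _
      _ ≤ M₂ + δ₂ := add_le_add hb₀ hb
  calc ‖a * b - a₀ * b₀‖ ≤ ‖a - a₀‖ * ‖b‖ + ‖a₀‖ * ‖b - b₀‖ := norm_mul_sub_mul_le _ _ _ _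
    _ ≤ δ₁ * (M₂ + δ₂) + M₁ * δ₂ := by gcongr

/-! ## The printed profiles: sup bounds and Lipschitz bounds on `|z| ≤ 1` -/

/-- `‖e^{kπiz}‖ = 1` (`k, z` real; the exponentials of (8.13)–(8.18)). [cite: Zhang2022LandauSiegel, §8 (8.13)–(8.18)] -/
theorem norm_cexp_kpiIz (k : ℚ) (z : ℝ) : ‖cexp (k * π * I * z)‖ = 1 := by
  have h : (k : ℂ) * π * I * z = (((k : ℝ) * π * z : ℝ) : ℂ) * I := by push_cast; ring
  rw [h, Complex.norm_exp_ofReal_mul_I]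

/-- `‖e^{−kπiz}‖ = 1` (`k, z` real; the exponentials of (8.13)–(8.18)). [cite: Zhang2022LandauSiegel, §8 (8.13)–(8.18)] -/
theorem norm_cexp_neg_kpiIz (k : ℚ) (z : ℝ) : ‖cexp (-(k * π * I * z))‖ = 1 := by
  have h : -((k : ℂ) * π * I * z) = ((-((k : ℝ) * π * z) : ℝ) : ℂ) * I := by push_cast; ring
  rw [h, Complex.norm_exp_ofReal_mul_I]

/-- `‖r + bπiz‖ ≤ |r| + |b|π` for `|z| ≤ 1` (the affine factors of (8.13)–(8.18)). [cite: Zhang2022LandauSiegel, §8 (8.13)–(8.18)] -/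
theorem norm_affine_le {r b : ℚ} {z : ℝ} (hz : |z| ≤ 1) :
    ‖(r : ℂ) + b * π * I * z‖ ≤ |(r : ℝ)| + |(b : ℝ)| * π := by
  calc ‖(r : ℂ) + b * π * I * z‖ ≤ ‖(r : ℂ)‖ + ‖(b : ℂ) * π * I * z‖ := norm_add_le _ _
    _ = |(r : ℝ)| + |(b : ℝ)| * π * |z| := by
        rw [norm_mul, norm_mul, norm_mul, Complex.norm_I, mul_one, Complex.norm_ratCast,
          Complex.norm_ratCast, Complex.norm_real, Complex.norm_real, Real.norm_eq_abs,
          Real.norm_eq_abs, abs_of_pos Real.pi_pos]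
    _ ≤ |(r : ℝ)| + |(b : ℝ)| * π * 1 := by gcongr
    _ = |(r : ℝ)| + |(b : ℝ)| * π := by ring

/-- `‖𝔣𝔣_{a,k}(z)‖ ≤ 1 + |a|π` for `|z| ≤ 1`. [cite: Zhang2022LandauSiegel, §8 (8.13)–(8.18)] -/
theorem norm_ffF_le (a k : ℚ) {z : ℝ} (hz : |z| ≤ 1) : ‖ffF a k z‖ ≤ 1 + |(a : ℝ)| * π := by
  unfold ffF
  rw [norm_mul, norm_cexp_kpiIz, mul_one]
  have h := norm_affine_le (r := 1) (b := a) hz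
  push_cast at h
  simpa using h

/-- `‖𝔤𝔥_{r₀,r₁,b,k}(z)‖ ≤ |r₀| + |r₁| + |b|π` for `|z| ≤ 1`. [cite: Zhang2022LandauSiegel, §8 (8.13)–(8.18)] -/
theorem norm_ghF_le (r0 r1 b k : ℚ) {z : ℝ} (hz : |z| ≤ 1) :
    ‖ghF r0 r1 b k z‖ ≤ |(r0 : ℝ)| + |(r1 : ℝ)| + |(b : ℝ)| * π := by
  unfold ghF
  calc ‖(r0 : ℂ) + (r1 + b * π * I * z) * cexp (-(k * π * I * z))‖
      ≤ ‖(r0 : ℂ)‖ + ‖(r1 + b * π * I * z) * cexp (-(k * π * I * z))‖ := norm_add_le _ _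
    _ = |(r0 : ℝ)| + ‖(r1 : ℂ) + b * π * I * z‖ := by
        rw [norm_mul, norm_cexp_neg_kpiIz, mul_one, Complex.norm_ratCast]
    _ ≤ |(r0 : ℝ)| + (|(r1 : ℝ)| + |(b : ℝ)| * π) := by gcongr; exact norm_affine_le hz
    _ = _ := by ring

/-- **`‖𝔣𝔣_{jμ}(z)‖ ≤ 6`** on `|z| ≤ 1`, all `j, μ` (dispatcher `ffP` of `Section8dStatements`).
[cite: Zhang2022LandauSiegel, §8 (8.13)–(8.18)] -/
theorem norm_ffP_le (j μ : ℕ) {z : ℝ} (hz : |z| ≤ 1) : ‖ffP j μ z‖ ≤ 6 := by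
  have hπ := Real.pi_lt_d2
  unfold ffP ff16 ff26 ff36 ff17 ff27 ff37
  split_ifs <;>
  · refine (norm_ffF_le _ _ hz).trans ?_
    push_cast
    norm_num [abs_of_pos Real.pi_pos]
    nlinarith

/-- **`‖𝔤𝔥_{jμ}(z)‖ ≤ 6`** on `|z| ≤ 1`, all `j, μ` (dispatcher `ghP`).
[cite: Zhang2022LandauSiegel, §8 (8.13)–(8.18)] -/
theorem norm_ghP_le (j μ : ℕ) {z : ℝ} (hz : |z| ≤ 1) : ‖ghP j μ z‖ ≤ 6 := by
  have hπ := Real.pi_lt_d2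
  unfold ghP gh16 gh26 gh36 gh17 gh27 gh37
  split_ifs <;>
  · refine (norm_ghF_le _ _ _ _ hz).trans ?_
    push_cast
    norm_num [abs_of_pos Real.pi_pos]
    nlinarith

/-- `‖e^{kπiz} − e^{kπiw}‖ ≤ |k|π|z − w|` (Lipschitz of `u ↦ e^{iu}` on `ℝ`; exponentials of (8.13)–(8.18)).
[cite: Zhang2022LandauSiegel, §8 (8.13)–(8.18)] -/
theorem norm_cexp_kpiIz_sub_le (k : ℚ) (z w : ℝ) :
    ‖cexp (k * π * I * z) - cexp (k * π * I * w)‖ ≤ |(k : ℝ)| * π * |z - w| := by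
  have h : cexp (k * π * I * z) - cexp (k * π * I * w) =
      cexp (k * π * I * w) * (cexp (I * (((k : ℝ) * π * (z - w) : ℝ) : ℂ)) - 1) := by
    rw [mul_sub, mul_one, ← Complex.exp_add]
    congr 1; push_cast; ring
  rw [h, norm_mul, norm_cexp_kpiIz, one_mul]
  refine Real.norm_exp_I_mul_ofReal_sub_one_le.trans (le_of_eq ?_)
  rw [Real.norm_eq_abs, abs_mul, abs_mul, abs_of_pos Real.pi_pos]

/-- `‖e^{−kπiz} − e^{−kπiw}‖ ≤ |k|π|z − w|` (exponentials of (8.13)–(8.18)). [cite: Zhang2022LandauSiegel, §8 (8.13)–(8.18)] -/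
theorem norm_cexp_neg_kpiIz_sub_le (k : ℚ) (z w : ℝ) :
    ‖cexp (-(k * π * I * z)) - cexp (-(k * π * I * w))‖ ≤ |(k : ℝ)| * π * |z - w| := by
  have h1 : -((k : ℂ) * π * I * z) = ((-k : ℚ) : ℂ) * π * I * z := by push_cast; ring
  have h2 : -((k : ℂ) * π * I * w) = ((-k : ℚ) : ℂ) * π * I * w := by push_cast; ring
  rw [h1, h2]
  refine (norm_cexp_kpiIz_sub_le (-k) z w).trans (le_of_eq ?_)
  push_cast; rw [abs_neg]

/-- Lipschitz bound for `𝔣𝔣_{a,k}` on `|z|, |w| ≤ 1`: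
`‖𝔣𝔣(z) − 𝔣𝔣(w)‖ ≤ (|a|π + (1 + |a|π)|k|π)|z − w|`. [cite: Zhang2022LandauSiegel, §8 (8.13)–(8.18)] -/
theorem ffF_sub_le (a k : ℚ) {z w : ℝ} (hw : |w| ≤ 1) :
    ‖ffF a k z - ffF a k w‖ ≤
      (|(a : ℝ)| * π + (1 + |(a : ℝ)| * π) * (|(k : ℝ)| * π)) * |z - w| := by
  unfold ffF
  have h : (1 + a * π * I * z) * cexp (k * π * I * z) - (1 + a * π * I * w) * cexp (k * π * I * w) =
      (a * π * I * ((z - w : ℝ) : ℂ)) * cexp (k * π * I * z) +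
        (1 + a * π * I * w) * (cexp (k * π * I * z) - cexp (k * π * I * w)) := by
    push_cast; ring
  rw [h]
  calc ‖(a * π * I * ((z - w : ℝ) : ℂ)) * cexp (k * π * I * z) +
          (1 + a * π * I * w) * (cexp (k * π * I * z) - cexp (k * π * I * w))‖
      ≤ ‖(a * π * I * ((z - w : ℝ) : ℂ)) * cexp (k * π * I * z)‖ +
          ‖(1 + a * π * I * w) * (cexp (k * π * I * z) - cexp (k * π * I * w))‖ := norm_add_le _ _
    _ ≤ |(a : ℝ)| * π * |z - w| + (1 + |(a : ℝ)| * π) * (|(k : ℝ)| * π * |z - w|) := by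
        rw [norm_mul, norm_cexp_kpiIz, mul_one, norm_mul, norm_mul, norm_mul, Complex.norm_I,
          mul_one, Complex.norm_ratCast, Complex.norm_real, Complex.norm_real, Real.norm_eq_abs,
          Real.norm_eq_abs, abs_of_pos Real.pi_pos, norm_mul]
        gcongr
        · have h1 := norm_affine_le (r := 1) (b := a) hw
          push_cast at h1
          simpa using h1
        · exact norm_cexp_kpiIz_sub_le k z w
    _ = _ := by ring

/-- Lipschitz bound for `𝔤𝔥_{r₀,r₁,b,k}` on `|z|, |w| ≤ 1`:
`‖𝔤𝔥(z) − 𝔤𝔥(w)‖ ≤ (|b|π + (|r₁| + |b|π)|k|π)|z − w|`. [cite: Zhang2022LandauSiegel, §8 (8.13)–(8.18)] -/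
theorem ghF_sub_le (r0 r1 b k : ℚ) {z w : ℝ} (hw : |w| ≤ 1) :
    ‖ghF r0 r1 b k z - ghF r0 r1 b k w‖ ≤
      (|(b : ℝ)| * π + (|(r1 : ℝ)| + |(b : ℝ)| * π) * (|(k : ℝ)| * π)) * |z - w| := by
  unfold ghF
  have h : (r0 : ℂ) + (r1 + b * π * I * z) * cexp (-(k * π * I * z)) -
      (r0 + (r1 + b * π * I * w) * cexp (-(k * π * I * w))) =
      (b * π * I * ((z - w : ℝ) : ℂ)) * cexp (-(k * π * I * z)) +
        (r1 + b * π * I * w) * (cexp (-(k * π * I * z)) - cexp (-(k * π * I * w))) := by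
    push_cast; ring
  rw [h]
  calc ‖(b * π * I * ((z - w : ℝ) : ℂ)) * cexp (-(k * π * I * z)) +
          (r1 + b * π * I * w) * (cexp (-(k * π * I * z)) - cexp (-(k * π * I * w)))‖
      ≤ ‖(b * π * I * ((z - w : ℝ) : ℂ)) * cexp (-(k * π * I * z))‖ +
          ‖(r1 + b * π * I * w) * (cexp (-(k * π * I * z)) - cexp (-(k * π * I * w)))‖ :=
        norm_add_le _ _
    _ ≤ |(b : ℝ)| * π * |z - w| + (|(r1 : ℝ)| + |(b : ℝ)| * π) * (|(k : ℝ)| * π * |z - w|) := by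
        rw [norm_mul, norm_cexp_neg_kpiIz, mul_one, norm_mul, norm_mul, norm_mul, Complex.norm_I,
          mul_one, Complex.norm_ratCast, Complex.norm_real, Complex.norm_real, Real.norm_eq_abs,
          Real.norm_eq_abs, abs_of_pos Real.pi_pos, norm_mul]
        gcongr
        · exact norm_affine_le hw
        · exact norm_cexp_neg_kpiIz_sub_le k z w
    _ = _ := by ring

/-- **`‖𝔣𝔣_{j6}(z) − 𝔣𝔣_{j6}(w)‖ ≤ 50|z − w|`** for `|w| ≤ 1` (dispatcher `ffP j 6`).
[cite: Zhang2022LandauSiegel, §8 (8.13)–(8.15)] -/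
theorem ffP_six_sub_le (j : ℕ) {z w : ℝ} (hw : |w| ≤ 1) : ‖ffP j 6 z - ffP j 6 w‖ ≤ 50 * |z - w| := by
  have hπ := Real.pi_lt_d2
  have hπ0 := Real.pi_pos
  have hzw := abs_nonneg (z - w)
  have hπsq : π ^ 2 < 10 := by nlinarith
  unfold ffP ff16 ff26 ff36
  simp only [show (6 : ℕ) ≠ 7 by decide, if_false]
  split_ifs <;>
  · refine (ffF_sub_le _ _ hw).trans (mul_le_mul_of_nonneg_right ?_ hzw)
    push_cast
    norm_num [abs_of_pos Real.pi_pos]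
    nlinarith

/-- **`‖𝔤𝔥_{j6}(z) − 𝔤𝔥_{j6}(w)‖ ≤ 50|z − w|`** for `|w| ≤ 1` (dispatcher `ghP j 6`).
[cite: Zhang2022LandauSiegel, §8 (8.13)–(8.15)] -/
theorem ghP_six_sub_le (j : ℕ) {z w : ℝ} (hw : |w| ≤ 1) : ‖ghP j 6 z - ghP j 6 w‖ ≤ 50 * |z - w| := by
  have hπ := Real.pi_lt_d2
  have hπ0 := Real.pi_pos
  have hzw := abs_nonneg (z - w)
  have hπsq : π ^ 2 < 10 := by nlinarith
  unfold ghP gh16 gh26 gh36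
  simp only [show (6 : ℕ) ≠ 7 by decide, if_false]
  split_ifs <;>
  · refine (ghF_sub_le _ _ _ _ hw).trans (mul_le_mul_of_nonneg_right ?_ hzw)
    push_cast
    norm_num [abs_of_pos Real.pi_pos]
    nlinarith

/-- `𝔣𝔣_{jμ}`, `𝔤𝔥_{jμ}` are continuous (dispatchers). [cite: Zhang2022LandauSiegel, §8 (8.13)–(8.18)] -/
theorem continuous_ffP_ghP (j μ : ℕ) : Continuous (ffP j μ) ∧ Continuous (ghP j μ) := by
  constructor
  · unfold ffP ff16 ff26 ff36 ff17 ff27 ff37; split_ifs <;> exact continuous_ffF _ _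
  · unfold ghP gh16 gh26 gh36 gh17 gh27 gh37; split_ifs <;> exact continuous_ghF _ _ _ _

/-! ## The parameters `P, P₁, P₂, T` in the variable `z` -/

section Params

variable (c' : ℝ) (D : ℕ)

/-- `Pᶻ = e^{𝓛⁹z}` ((2.6) `P = e^{𝓛⁹}`). [cite: Zhang2022LandauSiegel, §2 (2.6)] -/
theorem bigP_rpow_eq_exp (z : ℝ) : bigP D ^ z = rexp (ell D ^ 9 * z) := by
  rw [bigP, ← Real.exp_mul]

/-- `P₁ = P^{0.504} = Ppow 𝓛⁹ 0.504` ((2.21)). [cite: Zhang2022LandauSiegel, §2 (2.21)] -/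
theorem P1_eq_Ppow : Skeleton.P1 D = Ppow (ell D ^ 9) 0.504 := by
  rw [Skeleton.P1, Ppow, bigP, ← Real.exp_mul]

/-- `log P₂ = 0.5𝓛⁹ − 10𝓛^{1.1}` ((2.21) `P₂ = P^{0.5}T^{−10}`, `T = e^{𝓛^{1.1}}`).
[cite: Zhang2022LandauSiegel, §2 (2.21)] -/
theorem log_P2 : Real.log (Skeleton.P2 D) = 0.5 * ell D ^ 9 - 10 * ell D ^ (1.1 : ℝ) := by
  have hP : 0 < bigP D := Real.exp_pos _
  have hT : 0 < bigT D := Real.exp_pos _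
  rw [Skeleton.P2, Real.log_div (Real.rpow_pos_of_pos hP _).ne' (pow_pos hT _).ne', Real.log_rpow hP,
    Real.log_pow, bigP, bigT, Real.log_exp, Real.log_exp]
  push_cast; ring

/-- `P₂ = Ppow 𝓛⁹ θ₂` with `θ₂ = log P₂/𝓛⁹` (`D ≥ 2`, so `𝓛 ≠ 0`). [cite: Zhang2022LandauSiegel, §2 (2.21)] -/
theorem P2_eq_Ppow {D : ℕ} (hℓ : ell D ≠ 0) :
    Skeleton.P2 D = Ppow (ell D ^ 9) (Real.log (Skeleton.P2 D) / ell D ^ 9) := by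
  have hP2 : 0 < Skeleton.P2 D := div_pos (Real.rpow_pos_of_pos (Real.exp_pos _) _) (pow_pos (Real.exp_pos _) _)
  rw [Ppow, mul_div_cancel₀ _ (pow_ne_zero _ hℓ), Real.exp_log hP2]

/-- `θ₂ − 0.5 = −10𝓛^{1.1}𝓛⁻⁹` and hence `|θ₂ − 0.5| ≤ 10𝓛⁻⁷` for `𝓛 ≥ 1`, where
`θ₂ = log P₂/𝓛⁹`. [cite: Zhang2022LandauSiegel, §2 (2.21)] -/
theorem theta2_sub_half {D : ℕ} (hℓ : 1 ≤ ell D) :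
    |Real.log (Skeleton.P2 D) / ell D ^ 9 - 0.5| ≤ 10 * (ell D ^ 7)⁻¹ := by
  have hℓ0 : 0 < ell D := by linarith
  have h9 : ell D ^ 9 ≠ 0 := by positivity
  have e : Real.log (Skeleton.P2 D) / ell D ^ 9 - 0.5 = -(10 * ell D ^ (1.1 : ℝ) / ell D ^ 9) := by
    rw [log_P2]; field_simp; ring
  rw [e, abs_neg, abs_of_nonneg (by positivity)]
  have h11 : ell D ^ (1.1 : ℝ) ≤ ell D ^ 2 := by
    rw [← Real.rpow_natCast _ 2]
    exact Real.rpow_le_rpow_of_exponent_le hℓ (by norm_num)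
  calc 10 * ell D ^ (1.1 : ℝ) / ell D ^ 9 ≤ 10 * ell D ^ 2 / ell D ^ 9 := by gcongr
    _ = 10 * (ell D ^ 7)⁻¹ := by field_simp

/-- `P^{0.004}T^{10} = P₁/P₂` ("since `P₁/P₂ = P^{0.004}T^{10}`", p. 48). [cite: Zhang2022LandauSiegel, §8 (8.12)] -/
theorem bigP_rpow_mul_bigT_pow : bigP D ^ (0.004 : ℝ) * bigT D ^ 10 = Skeleton.P1 D / Skeleton.P2 D := by
  have hP : 0 < bigP D := Real.exp_pos _
  have hT : 0 < bigT D := Real.exp_pos _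
  have h5 : (0 : ℝ) < bigP D ^ (0.5 : ℝ) := Real.rpow_pos_of_pos hP _
  rw [Skeleton.P1, Skeleton.P2, show (0.504 : ℝ) = 0.5 + 0.004 by norm_num, Real.rpow_add hP]
  field_simp

/-- `z ↦ 𝔣_{jμ}(e^{Λz})` is continuous (it is `z ↦ (1 + (β_μ − β_j)Λz)e^{β_μΛz}`).
[cite: Zhang2022LandauSiegel, §8 Lemma 8.2] -/
theorem continuous_frakfW_exp (j μ : ℕ) (Λ : ℝ) :
    Continuous fun z : ℝ => frakfW c' D j μ (rexp (Λ * z)) := by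
  unfold frakfW frakf
  simp only [Real.log_exp]
  fun_prop

/-- `z ↦ 𝔤_{jμ}(e^{Λz})` is continuous. [cite: Zhang2022LandauSiegel, §8 Lemma 8.4] -/
theorem continuous_frakgW_exp (j μ : ℕ) (Λ : ℝ) :
    Continuous fun z : ℝ => frakgW c' D j μ (rexp (Λ * z)) := by
  unfold frakgW frakg
  simp only [Real.log_exp]
  fun_prop

/-- `𝓛 ≥ 2` for `D ≥ 8` (`e² < 8`). [cite: Zhang2022LandauSiegel, §2 (2.1)] -/
theorem two_le_ell {D : ℕ} (hD : 8 ≤ D) : 2 ≤ ell D := by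
  have hD' : (8 : ℝ) ≤ D := by exact_mod_cast hD
  have h : (2 : ℝ) ≤ Real.log 8 := by
    rw [Real.le_log_iff_exp_le (by norm_num)]
    have h1 := Real.exp_one_lt_d9
    have h2 : Real.exp 2 = Real.exp 1 ^ 2 := by rw [← Real.exp_nat_mul]; norm_num
    rw [h2]; nlinarith [Real.exp_pos 1]
  exact h.trans (Real.log_le_log (by norm_num) hD')

end Params

/-! ## Appendix (sz-d19, append 1): Lipschitz bounds for the `μ = 7` profiles -/

/-- **`‖𝔣𝔣_{j7}(z) − 𝔣𝔣_{j7}(w)‖ ≤ 50|z − w|`** for `|w| ≤ 1` (dispatcher `ffP j 7`; `k = 5/2`, worst case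
`4π + 3.75π² < 50`). Used by the cross terms of §9 ((9.5)–(9.6), shift `0.002`) and §10.
[cite: Zhang2022LandauSiegel, §8 (8.16)–(8.18)] -/
theorem ffP_seven_sub_le (j : ℕ) {z w : ℝ} (hw : |w| ≤ 1) :
    ‖ffP j 7 z - ffP j 7 w‖ ≤ 50 * |z - w| := by
  have hπ := Real.pi_lt_d2
  have hπ0 := Real.pi_pos
  have hzw := abs_nonneg (z - w)
  have hπsq : π ^ 2 < 9.93 := by nlinarith
  unfold ffP ff17 ff27 ff37
  simp only [if_true]
  split_ifs <;>
  · refine (ffF_sub_le _ _ hw).trans (mul_le_mul_of_nonneg_right ?_ hzw)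
    push_cast
    norm_num [abs_of_pos Real.pi_pos]
    nlinarith

/-- **`‖𝔤𝔥_{j7}(z) − 𝔤𝔥_{j7}(w)‖ ≤ 50|z − w|`** for `|w| ≤ 1` (dispatcher `ghP j 7`).
[cite: Zhang2022LandauSiegel, §8 (8.16)–(8.18)] -/
theorem ghP_seven_sub_le (j : ℕ) {z w : ℝ} (hw : |w| ≤ 1) :
    ‖ghP j 7 z - ghP j 7 w‖ ≤ 50 * |z - w| := by
  have hπ := Real.pi_lt_d2
  have hπ0 := Real.pi_pos
  have hzw := abs_nonneg (z - w)
  have hπsq : π ^ 2 < 9.93 := by nlinarith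
  unfold ghP gh17 gh27 gh37
  simp only [if_true]
  split_ifs <;>
  · refine (ghF_sub_le _ _ _ _ hw).trans (mul_le_mul_of_nonneg_right ?_ hzw)
    push_cast
    norm_num [abs_of_pos Real.pi_pos]
    nlinarith

/-- Lipschitz bound `≤ 50|z − w|` for ALL the printed profiles `ffP j μ`, `ghP j μ` (`μ = 7`, and any
`μ ≠ 7`, which the dispatchers send to the `μ = 6` profiles), `|w| ≤ 1`.
[cite: Zhang2022LandauSiegel, §8 (8.13)–(8.18)] -/
theorem ffP_ghP_sub_le (j μ : ℕ) {z w : ℝ} (hw : |w| ≤ 1) :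
    ‖ffP j μ z - ffP j μ w‖ ≤ 50 * |z - w| ∧ ‖ghP j μ z - ghP j μ w‖ ≤ 50 * |z - w| := by
  by_cases hμ : μ = 7
  · subst hμ; exact ⟨ffP_seven_sub_le j hw, ghP_seven_sub_le j hw⟩
  · have hf : ffP j μ = ffP j 6 := by simp [ffP, hμ]
    have hg : ghP j μ = ghP j 6 := by simp [ghP, hμ]
    rw [hf, hg]
    exact ⟨ffP_six_sub_le j hw, ghP_six_sub_le j hw⟩

end Literature.NumberTheory.LFunctions.Zhang2022.Section8SubstitutionEngine
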